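/-
Origin: expansion seat `planner-pub-hodgecm-pv10-0`, handover #2 2026-08-18T03:58:33Z (`HOME/pub-hodgecm-pv10/lean/Pv10/HeckeCharExtensionCont.lean`, md5 9421c21f, 83 lines);
landed by the gen-5 packager in gate run 20 as `HodgeCM/PerL34/HeckeCharExtensionCont.lean` (import ^import Pv[0-9]+\.→import HodgeCM.PerL34. ×2).
-/
/-
Origin: planner-pub-hodgecm-pv10-0 (unit pub-hodgecm-pv10), HodgeCM publication cell, 2026-08-18.
Node N15 (PerL v5 §3.2, tex ll. 304–314) over Mathlib's REAL ideles, CONTINUOUS form: every continuous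
unitary character of any subgroup of `C_K` containing the classes of `K_∞^×` extends to a unitary Hecke
character.  At landing the `Pv10.*` imports become `HodgeCM.PerL34.*`.
-/
import Summits.HodgeConjecture.HodgeCM.PerL34.HeckeCharExtension
import Summits.HodgeConjecture.HodgeCM.PerL34.UnitsNonarchimedean

/-!
# N15 over Mathlib's ideles, continuous form

With `UnitsNonarchimedean` (`(∏_v 𝒪_v)^×` is a nonarchimedean group) the conductor hypothesis of
`NumberField.exists_unitaryHeckeCharacter_extension` is produced from mere continuity of `χ` along
`(∏_v 𝒪_v)^×` (node N31g's no-small-subgroups step, `CharExtensionN15` §3), giving: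

* `NumberField.exists_unitaryHeckeCharacter_extension_of_continuous` — `B ≤ C_K` ANY subgroup with
  `[K_∞^×] ⊆ B`, `χ : B →* S¹` continuous (subspace topology) ⇒ `χ = ψ|_B` for a unitary Hecke
  character `ψ`.  (For `B` closed this is the idelic case of the carver's general-LCA target
  `N15_core_charExtension`; no closedness is needed, and no Pontryagin duality is used.)
-/

set_option autoImplicit false

noncomputable section

open Topology Filter Set

namespace NumberField

open HodgeCM.PerL34.CharExtensionN15

variable (K : Type*) [Field K] [NumberField K]

/-- **N15 over real ideles, two-continuity form.**  `χ` continuous along `K_∞^×` and along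
`(∏_v 𝒪_v)^×` (pulled back) extends to a unitary Hecke character. -/
theorem exists_unitaryHeckeCharacter_extension_of_continuous_inf_int (B : Subgroup (IdeleClassGroup K))
    (hNB : ∀ x : (InfiniteAdeleRing K)ˣ, infUnitsToClass K x ∈ B) (χ : B →* Circle)
    (hχinf : Continuous fun x : (InfiniteAdeleRing K)ˣ => χ ⟨infUnitsToClass K x, hNB x⟩)
    (hχint : Continuous fun u : B.comap (intUnitsToClass K) => χ ⟨intUnitsToClass K u, u.2⟩) :
    ∃ ψ : UnitaryHeckeCharacter K, ∀ b : B, ψ (b : IdeleClassGroup K) = χ b := by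
  obtain ⟨χ', hcont, hext⟩ :=
    exists_continuous_circleChar_extension_of_nhds_mul (G := IdeleClassGroup K)
      (N := (InfiniteAdeleRing K)ˣ) (K := (integralAdeles K)ˣ) B (infUnitsToClass K)
      (intUnitsToClass K) hNB (fun _ hs => image_infUnits_mul_intUnits_mem_nhds K hs) χ hχinf hχint
  exact ⟨{ χ' with continuous_toFun := hcont }, hext⟩

/-- **N15 over real ideles, continuous form.**  Every continuous unitary character of a subgroup
`B ≤ C_K` containing the classes of `K_∞^×` is the restriction of a unitary Hecke character of `K`. -/
theorem exists_unitaryHeckeCharacter_extension_of_continuous (B : Subgroup (IdeleClassGroup K))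
    (hNB : ∀ x : (InfiniteAdeleRing K)ˣ, infUnitsToClass K x ∈ B) (χ : B →* Circle)
    (hχ : Continuous χ) :
    ∃ ψ : UnitaryHeckeCharacter K, ∀ b : B, ψ (b : IdeleClassGroup K) = χ b := by
  refine exists_unitaryHeckeCharacter_extension_of_continuous_inf_int K B hNB χ ?_ ?_
  · exact hχ.comp ((continuous_infUnitsToClass K).subtype_mk _)
  · exact hχ.comp (((continuous_intUnitsToClass K).comp continuous_subtype_val).subtype_mk _)

/-- The conductor exists: a continuous unitary character of such a `B` is trivial on `B ∩ [U]` for some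
open subgroup `U ≤ (∏_v 𝒪_v)^×` (no small subgroups in `(∏_v 𝒪_v)^×`). -/
theorem exists_openSubgroup_intUnits_trivialOn (B : Subgroup (IdeleClassGroup K)) (χ : B →* Circle)
    (hχ : Continuous χ) :
    ∃ U : OpenSubgroup (integralAdeles K)ˣ,
      ∀ b : B, (b : IdeleClassGroup K) ∈ (U : Subgroup (integralAdeles K)ˣ).map (intUnitsToClass K) →
        χ b = 1 := by
  let BK : Subgroup (integralAdeles K)ˣ := B.comap (intUnitsToClass K)
  let χK : BK →* Circle := χ.comp ((intUnitsToClass K).subgroupComap B)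
  have hχK : Continuous χK :=
    hχ.comp (((continuous_intUnitsToClass K).comp continuous_subtype_val).subtype_mk _)
  obtain ⟨U, hU⟩ := exists_openSubgroup_trivialOn (G := (integralAdeles K)ˣ) BK χK hχK
  refine ⟨U, fun b hb => ?_⟩
  obtain ⟨u, hu, hub⟩ := Subgroup.mem_map.mp hb
  have huB : intUnitsToClass K u ∈ B := by rw [hub]; exact b.2
  have h := hU ⟨u, huB⟩ hu
  have heq : χK ⟨u, huB⟩ = χ b := by
    show χ (((intUnitsToClass K).subgroupComap B) ⟨u, huB⟩) = χ b
    congr 1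
    exact Subtype.ext hub
  rw [heq] at h
  exact h

end NumberField

end
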